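import Summits.AnomalousDissipation.AnomalousDissipation.Theses.ImpulseGrid

/-!
# Sketch — first lemmas of the crux ideas for `ImpulseGrid.GridThesis` (stmt-AnomalousDissipation-1770)
crux-ideate round 1, ideator 1. Props only (no proofs required); each must elaborate.
-/

set_option linter.dupNamespace false
noncomputable section

namespace Summit.AnomalousDissipation.AnomalousDissipation.Cruxes.GridThesis.IdeaSketch

open MeasureTheory Filter Set
open Literature.Analysis.FunctionSpaces Literature.Analysis.FunctionSpaces.Torus
open Literature.Analysis.FluidPDE

local notation "𝕋³" => UnitAddTorus (Fin 3)
local notation "𝕋²" => UnitAddTorus (Fin 2)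
local notation "E³" => EuclideanSpace ℝ (Fin 3)

/-- The unit vector `e₀` (streamwise direction). -/
def e₀ : E³ := EuclideanSpace.single (0 : Fin 3) 1

/-! ## Card `burn-window-ledger` — first lemmas -/

/-- **Profile identity** (age-profile ledger, momentum side): the sawtooth identity of
`GridInjectionIdentity` holds for EVERY smooth `x⊥`-invariant weight `Ψt(x₀)`, not only for the
zero-mean primitive of `Φ − 1`. Corollary of `ImpulseGrid.MeanMomentumBalance` with the admissible
test field `Ψt • G` (div-free because `∂₀G = 0`, `G₀ = 0`) and the pointwise algebra
`⟪u,(u·∇)(Ψt G)⟫ = c ∂₀Ψt ⟪w,G⟫ + ⟪w,(w·∇)(Ψt G)⟫`, `w = u − c e₀`. Pairing the identity with a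
dense family of weights `Ψt` is what turns the Banach means into MEASURES on the circuit circle
(G-momentum profile `J`, cross flux `τ`, transverse stress `σ⊥`). -/
def ProfileIdentity : Prop :=
  ∀ (Λ : GeneralizedLimit) (ν c : ℝ) (Φ Ψt : 𝕋³ → ℝ) (G : 𝕋³ → E³) (u₀ : 𝕋³ → E³)
    (u : ℝ → 𝕋³ → E³),
    0 < ν → IsSmooth Φ → IsSmooth Ψt → IsSmooth G →
    (∀ (s : UnitAddCircle) x, Φ (x + Pi.single (1 : Fin 3) s) = Φ x ∧ Φ (x + Pi.single (2 : Fin 3) s) = Φ x) →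
    (∀ (s : UnitAddCircle) x, Ψt (x + Pi.single (1 : Fin 3) s) = Ψt x ∧ Ψt (x + Pi.single (2 : Fin 3) s) = Ψt x) →
    (∀ (s : UnitAddCircle) x, G (x + Pi.single (0 : Fin 3) s) = G x) → (∀ x, G x 0 = 0) → IsDivFree G →
    Torus.IsGlobalLerayHopf ν (fun _ => fun x => Φ x • G x) u₀ u →
    (∃ C : ℝ, ∀ t : ℝ, 0 ≤ t → kineticEnergy (u t) ≤ C) →
    c * Λ.longTimeAvg (fun t => ∫ x, partialDeriv 0 Ψt x * inner ℝ (G x) (u t x))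
      + Λ.longTimeAvg (fun t => ∫ x, inner ℝ (u t x - c • e₀)
          (convect (fun y => u t y - c • e₀) (fun y => Ψt y • G y) x))
      + ν * Λ.longTimeAvg (fun t => ∫ x, inner ℝ (u t x) (laplacian (fun y => Ψt y • G y) x))
      + ∫ x, Φ x * Ψt x * ‖G x‖ ^ 2 = 0

/-- **Bernoulli pinning of the mean pressure profile** (age-profile ledger, energy side; exact at
every instant for classical solutions): if the force has no streamwise component then the
transverse average of `u₀² + p` does not depend on the streamwise station `x₀`. (Transverse average
of the `e₀`-momentum equation; `⟨u₀⟩⊥ ≡ ∫u₀` by incompressibility.) It removes the pressure from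
the streamwise energy flux: `F(x₀) = const + (c/2)·e_w(x₀) + T(x₀)`. -/
def BernoulliPinning : Prop :=
  ∀ (ν : ℝ) (f : 𝕋³ → E³) (u : ℝ → 𝕋³ → E³) (p : ℝ → 𝕋³ → ℝ),
    0 < ν → Torus.IsClassicalNSSolutionOn Set.univ ν (fun _ => f) u p → (∀ x, f x 0 = 0) →
    ∀ (t : ℝ) (s s' : UnitAddCircle),
      ∫ y : 𝕋², ((u t (Fin.cons s y) 0) ^ 2 + p t (Fin.cons s y))
        = ∫ y : 𝕋², ((u t (Fin.cons s' y) 0) ^ 2 + p t (Fin.cons s' y))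

/-- **Cauchy–Schwarz squeeze of the G-momentum profile by the fluctuation-energy profile**
(weighted Banach-mean form, no slicing needed): for every nonnegative smooth weight `χ(x₀)`,
`|Λ⟨∫ χ ⟪G, u − c e₀⟫⟩| ≤ ‖G‖_{L²(⊥)} · (∫χ)^{1/2} · Λ⟨∫ χ |u − c e₀|²⟩^{1/2}`; here
`‖G‖_{L²(⊥)}² = ∫ ‖G‖²` on the probability torus. This is the inequality that lets an UNSIGNED
decay statement about `e_w` control the SIGNED correlation profile `J`. -/
def MomentumEnergySqueeze : Prop :=
  ∀ (Λ : GeneralizedLimit) (c : ℝ) (χ : 𝕋³ → ℝ) (G : 𝕋³ → E³) (u : ℝ → 𝕋³ → E³),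
    IsSmooth χ → (∀ x, 0 ≤ χ x) → IsSmooth G →
    (∀ (s : UnitAddCircle) x, χ (x + Pi.single (1 : Fin 3) s) = χ x ∧ χ (x + Pi.single (2 : Fin 3) s) = χ x) →
    (∃ C : ℝ, ∀ t : ℝ, 0 ≤ t → kineticEnergy (u t) ≤ C) →
    (∀ t, 0 ≤ t → AEStronglyMeasurable (u t) volume) →
    |Λ.longTimeAvg (fun t => ∫ x, χ x * inner ℝ (G x) (u t x - c • e₀))|
      ≤ Real.sqrt (∫ x, ‖G x‖ ^ 2) * Real.sqrt (∫ x, χ x)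
          * Real.sqrt (Λ.longTimeAvg (fun t => ∫ x, χ x * ‖u t x - c • e₀‖ ^ 2))

/-! ## Card `hyperbolic-clock` — first lemma -/

/-- Classical solutions of the Euler equations LINEARISED about a steady smooth field `V` on
`T³`: `∂ₜw + (V·∇)w + (w·∇)V + ∇q = 0`, `div w = 0` (pointwise, jointly smooth). -/
def IsLinearisedEulerSolution (V : 𝕋³ → E³) (w : ℝ → 𝕋³ → E³) (q : ℝ → 𝕋³ → ℝ) : Prop :=
  IsSmoothSpaceTimeOn (Set.Ici 0) w ∧ IsSmoothSpaceTimeOn (Set.Ici 0) q ∧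
    (∀ t ∈ Set.Ici (0 : ℝ), IsDivFree (w t)) ∧
    ∀ t ∈ Set.Ici (0 : ℝ), ∀ x,
      Torus.timeDerivWithin (Set.Ici 0) w t x + convect V (w t) x + convect (w t) V x
        = - Torus.gradient (q t) x

/-- **Hyperbolic clock** (Friedlander–Vishik / Lifschitz–Hameiri growth, stated as a lower bound
on the linearised Euler evolution about the kicked cell array `a • G`): if the transverse pattern
`G` is a steady Euler state (`(G·∇)G` is a gradient) with a stagnation point `x⋆` where `∇G`
has a real eigenvalue `s₀ > 0` (hyperbolic strain), then the linearised evolution about `a•G`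
has, for every `θ > 0` and every horizon `t ≥ 0`, a solution with unit initial energy grown by at
least `e^{(a s₀ − θ) t}` at time `t` (operator-norm form of Vishik's `r_ess(e^{tL}) = e^{tμ}`,
`μ ≥ a s₀`): the kicked array supplies its own ν-free clock `a s₀ = s₀/c` per unit time, i.e.
`s₀/c²` e-folds per circuit — in the route's regime `‖∇G‖/c² ≫ 1`, many e-folds per pass. -/
def HyperbolicClock : Prop :=
  ∀ (G : 𝕋³ → E³) (a s₀ θ : ℝ) (xs : 𝕋³) (v : E³),
    IsSmooth G → IsDivFree G → (∀ (s : UnitAddCircle) x, G (x + Pi.single (0 : Fin 3) s) = G x) →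
    (∀ x, G x 0 = 0) → (∃ π₀ : 𝕋³ → ℝ, IsSmooth π₀ ∧ ∀ x, convect G G x = Torus.gradient π₀ x) →
    G xs = 0 → v ≠ 0 → Torus.fderiv G xs v = s₀ • v → 0 < s₀ → 0 < a → 0 < θ →
    ∀ t : ℝ, 0 ≤ t →
      ∃ (w : ℝ → 𝕋³ → E³) (q : ℝ → 𝕋³ → ℝ),
        IsLinearisedEulerSolution (fun x => a • G x) w q ∧ (∫ x, ‖w 0 x‖ ^ 2 = 1) ∧
        Real.exp ((a * s₀ - θ) * t) ≤ Real.sqrt (∫ x, ‖w t x‖ ^ 2)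

end Summit.AnomalousDissipation.AnomalousDissipation.Cruxes.GridThesis.IdeaSketch

end
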